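import Summits.ValiantsHypothesis.ValiantsHypothesis.Theorems.KPlusLogSqLawTropicalShiftThreeChain

/-!
# Route «KPlusLogSqLaw» — SHIFT-THREE patchworked: Descartes' rule for three-term `m × m` determinantal pencils is
# sharp up to one, for every `m`

HONEST FRAMING.  Census-side corollary (general, NOT necessarily symmetric, pencils) of the explicit `K = 3` tropical
family SHIFT-THREE (`…TropicalShiftThree{Defs,,Chain}.lean`, seat val-sym-lift-p3 of the object-search cell
`pub-symmetroid`, 2026-08-26), recorded as a helper of the crux `MatrixDescartes` (`stmt-ValiantsHypothesis-18050`; the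
crux is symmetry-free, `matrixDescartesGeneral_of_matrixDescartes`).  By Viro patchworking (tree theorem
`MatrixDescartes.Negative.le_card_posRoots_patch`) the chain of `C(m+2,2) − 1` sign-alternating unique optima of the
design gives, for every `m = n + 1 ≥ 1`, a REAL three-term pencil `T₀ + X·T₁ + X^D·T₂` of `m × m` matrices
(`D = m(2m+3)`) whose determinant has at least `C(m+2,2) − 2` distinct positive zeros — one below the Descartes ceiling
`C(m+2,2) − 1` of the format (`stub_descartesCeiling`), uniformly in `m`.  The cell's conjecture «the `K = 3` column is
Descartes-extremal» (`KThreeColumnLaw`, symmetric pencils, exact value `C(m+2,2) − 1`) is untouched: this file gives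
general pencils and one zero less; nothing here bears on `MatrixDescartes` in its window, on `KPlusLogSqLaw`, or on
`VP ≠ VNP`.
-/

set_option linter.dupNamespace false
set_option autoImplicit false

namespace Summit.ValiantsHypothesis.ValiantsHypothesis.Theorems.LacunarySymmetroidMatrixDescartes.TropicalCensus

open Summit.ValiantsHypothesis.ValiantsHypothesis.Theorems.MatrixDescartes.Negative
open scoped BigOperators
open Finset Polynomial

namespace ShiftThree

variable (n : ℕ)

/-- the grid is nonempty: `T m ≥ 1`. -/
theorem one_le_T_last : 1 ≤ T n (n + 1) := by
  rw [T_succ]; omega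

/-- the chain of slopes `θ_k = θ(p_k, a_k)`, `k ≤ T m − 1`, is strictly increasing. -/
theorem chain_strictMono :
    StrictMono (fun k : Fin (T n (n + 1) - 1 + 1) => th n (grid n k).1 (grid n k).2) := by
  have h1 := one_le_T_last n
  refine Fin.strictMono_iff_lt_succ.mpr fun k => ?_
  simp only [Fin.val_castSucc, Fin.val_succ]
  exact th_grid_lt n k (by omega)

/-- every chain term is the unique optimum at its slope. -/
theorem chain_dominant (k : Fin (T n (n + 1) - 1 + 1)) :
    IsDominant (dd n) (vv n) (ee n) (th n (grid n k).1 (grid n k).2) (cterm n (grid n k).1 (grid n k).2) := by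
  have h1 := one_le_T_last n
  obtain ⟨h2, _⟩ := grid_inv n k (by omega)
  exact isDominant_cterm n _ _ (grid_fst_le n k (by omega)) h2

/-- consecutive chain terms have opposite signs. -/
theorem chain_alternates (k : Fin (T n (n + 1) - 1)) :
    termSign (ee n) (cterm n (grid n (Fin.castSucc k)).1 (grid n (Fin.castSucc k)).2) *
      termSign (ee n) (cterm n (grid n k.succ).1 (grid n k.succ).2) < 0 := by
  have h1 := one_le_T_last n
  simp only [Fin.val_castSucc, Fin.val_succ]
  rw [termSign_grid n k (by omega), termSign_grid n (k + 1) (by omega), ← pow_add,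
    show (k : ℕ) + (k + 1) = 2 * k + 1 by ring, pow_succ, pow_mul]
  norm_num

/-- **Descartes' rule for three-term `m × m` determinantal pencils is sharp up to one (`m = n + 1`, every `n`):**
some real pencil `T₀ + X·T₁ + X^D·T₂` (`D = m(2m+3)`) has at least `C(m+2,2) − 2` distinct positive zeros of its
determinant (the ceiling is `C(m+2,2) − 1`).  Patchworking of the SHIFT-THREE chain. -/
theorem exists_pencil_three_posRoots :
    ∃ T : Fin 3 → Matrix (Fin (n + 1)) (Fin (n + 1)) ℝ,
      (n + 3).choose 2 - 2 ≤ ((∑ l, (X : ℝ[X]) ^ dd n l • (T l).map Polynomial.C).det.roots.toFinset.filter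
        (fun t => 0 < t)).card := by
  obtain ⟨T, hT⟩ := le_card_posRoots_patch (dd n) (vv n) (ee n) (ee_natAbs n)
    (fun k : Fin (T n (n + 1) - 1 + 1) => th n (grid n k).1 (grid n k).2) (chain_strictMono n)
    (fun k => cterm n (grid n k).1 (grid n k).2) (chain_dominant n) (chain_alternates n)
  refine ⟨T, le_trans (le_of_eq ?_) hT⟩
  have := T_last n
  omega

end ShiftThree

end Summit.ValiantsHypothesis.ValiantsHypothesis.Theorems.LacunarySymmetroidMatrixDescartes.TropicalCensus
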